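import Summits.MatrixMultiplication.MatrixMultiplication.Theorems.SoloBlindWindowThreeLemmas

/-!
# The window inequality (E≤3) off the diagonal, in all ranks (solo-blind, door I1⁗ / (K₃), s80)

Setting of `SoloBlindWindowTwo` / `SoloBlindWindowThreeLemmas`: `h : ι → G` (`G` abelian of exponent `3`)
zero-sum free on `S`, `τ` H-GOOD (no sub-sum over `S` equals `τ + τ`), `N_k(τ)` = number of `k`-subsets of `S`
with `h`-sum `τ`.  The all-rank window inequality

  (E≤3)   N_3 + 2·N_2 + 4·N_1 ≤ 4     (Σ_{1 ≤ |T| ≤ 3} 2^{-|T|} ≤ 1/2)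

was so far a census theorem.  This file proves it by short explicit arguments in every case except the diagonal
one (`N_1 = N_2 = 0`, which is H(3) = 4 and is taken as a hypothesis in `soloBlind_window_three_of_H3`):

* `soloBlind_hgood_key` — the configuration `{x,y}` (sum `τ`), `{u,v}, {u',v}` (sum `h y`, inside
  `S' ⊆ S ∖ {x,y}`) kills every `h x`-pair `R ⊆ S'`: `R` meets both pairs (else `R ∪ {u,v} ∪ {x,y}` sums to
  `τ+τ`); `R = {u,u'}` forces `h v = τ` so `{v,x,y}` sums to `τ+τ`; `R = {v,t}` makes `{t,x,u,u'}` sum to `τ+τ`.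
* `soloBlind_hgood_pair_triples_le_two` — one pair representing `τ` leaves at most two triples
  (`N_3 ≤ A_x + A_y`, links H-good so `A_x, A_y ≤ 2` by H(2), and `A_x = 2 ⟹ A_y = 0` by the key lemma).
* `soloBlind_window_three_off_diagonal` — (E≤3) whenever `N_1 ≠ 0` or `N_2 ≠ 0` (unconditional, all ranks);
  `soloBlind_window_three_of_H3` — (E≤3) given H(3) at the point; `soloBlind_H2_three_of_pair`;
  `soloBlind_window_three_pair_attained` — `N_2 = 1, N_3 = 2` occurs (sharpness), by `decide`.
-/

namespace Summit.MatrixMultiplication.MatrixMultiplication.Theorems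

open Finset

variable {ι G : Type*} [DecidableEq ι] [AddCommGroup G] [DecidableEq G]

/-- KEY CONFIGURATION: a pair `{x, y}` representing `τ`, and in `S' ⊆ S ∖ {x, y}` two `h y`-pairs `{u, v}`, `{u', v}`
sharing `v`.  Then no pair `R ⊆ S'` has sum `h x`: `R` meets both (else `R ∪ {u,v} ∪ {x,y}` has sum `τ + τ`);
`R = {u, u'}` forces `h v = τ`, so `{v, x, y}` has sum `τ + τ`; `R = {v, t}` makes `{t, x, u, u'}` sum to `τ + τ`. -/
theorem soloBlind_hgood_key (three : ∀ g : G, g + g + g = 0) {h : ι → G} {S S' : Finset ι} {τ : G}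
    (hgood : ∀ T ⊆ S, ∑ i ∈ T, h i ≠ τ + τ) {x y : ι}
    (hP : ({x, y} : Finset ι) ∈ soloBlindSeqRep h S 2 τ) (hS' : S' ⊆ S) (hxS' : x ∉ S') (hyS' : y ∉ S')
    {u u' v : ι} (hu : u ∈ S') (hu' : u' ∈ S') (hv : v ∈ S') (huu' : u ≠ u') (huv : u ≠ v)
    (hu'v : u' ≠ v) (hcu : h u + h v = h y) (hcu' : h u' + h v = h y)
    {R : Finset ι} (hR : R ∈ soloBlindSeqRep h S' 2 (h x)) : False := by
  obtain ⟨hPS, hPc, hPsum⟩ := soloBlind_mem_seqRep.mp hP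
  have hxy : x ≠ y := by
    intro e; rw [e] at hPc; simp at hPc
  rw [Finset.sum_pair hxy] at hPsum
  have hab : h x ≠ h y := soloBlind_hgood_pair_values_ne three hgood hP
  have hxS : x ∈ S := hPS (Finset.mem_insert_self x {y})
  have hyS : y ∈ S := hPS (Finset.mem_insert_of_mem (Finset.mem_singleton_self y))
  have huu'v : h u' = h u := add_right_cancel (hcu'.trans hcu.symm)
  obtain ⟨hRS', hRc, hRsum⟩ := soloBlind_mem_seqRep.mp hR
  -- R meets every h y-pair {p, q} ⊆ S' (else R ∪ {p, q} ∪ {x, y} has sum τ + τ)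
  have meets : ∀ {p q : ι}, p ∈ S' → q ∈ S' → p ≠ q → h p + h q = h y → p ∈ R ∨ q ∈ R := by
    intro p q hp hq hpq hs
    by_contra hnot
    rw [not_or] at hnot
    have hd1 : Disjoint R {p, q} := by
      rw [Finset.disjoint_right]
      intro w hw
      simp only [Finset.mem_insert, Finset.mem_singleton] at hw
      rcases hw with hw | hw
      · rw [hw]; exact hnot.1
      · rw [hw]; exact hnot.2
    have hsub1 : R ∪ {p, q} ⊆ S' :=
      Finset.union_subset hRS' (Finset.insert_subset hp (Finset.singleton_subset_iff.mpr hq))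
    have hd2 : Disjoint (R ∪ {p, q}) {x, y} := by
      rw [Finset.disjoint_right]
      intro w hw
      simp only [Finset.mem_insert, Finset.mem_singleton] at hw
      rcases hw with hw | hw
      · rw [hw]; exact fun hw => hxS' (hsub1 hw)
      · rw [hw]; exact fun hw => hyS' (hsub1 hw)
    have hZ : ∑ i ∈ (R ∪ {p, q}) ∪ {x, y}, h i = τ + τ := by
      rw [Finset.sum_union hd2, Finset.sum_union hd1, Finset.sum_pair hpq, Finset.sum_pair hxy, hRsum, hs,
        ← hPsum]
    exact hgood _ (Finset.union_subset (hsub1.trans hS') hPS) hZ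
  have m1 := meets hu hv huv hcu
  have m2 := meets hu' hv hu'v hcu'
  by_cases hvR : v ∈ R
  · -- R = {v, t}: the set {t, x, u, u'} has sum τ + τ
    have hKc : (R.erase v).card = 1 := by rw [Finset.card_erase_of_mem hvR, hRc]
    obtain ⟨t, hK⟩ := Finset.card_eq_one.mp hKc
    have e := Finset.add_sum_erase R h hvR
    rw [hK, Finset.sum_singleton, hRsum] at e
    -- e : h v + h t = h x
    have htR : t ∈ R := Finset.mem_of_mem_erase (by rw [hK]; exact Finset.mem_singleton_self t)
    have htS' : t ∈ S' := hRS' htR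
    have htx : t ≠ x := fun e' => hxS' (e' ▸ htS')
    have htu : t ≠ u := by
      intro e'
      rw [e'] at e
      exact hab (e.symm.trans ((add_comm _ _).trans hcu))
    have htu' : t ≠ u' := by
      intro e'
      rw [e'] at e
      exact hab (e.symm.trans ((add_comm _ _).trans hcu'))
    have hxu : x ≠ u := fun e' => hxS' (e'.symm ▸ hu)
    have hxu' : x ≠ u' := fun e' => hxS' (e'.symm ▸ hu')
    have ht_notin : t ∉ insert x ({u, u'} : Finset ι) := by
      simp only [Finset.mem_insert, Finset.mem_singleton, not_or]
      exact ⟨htx, htu, htu'⟩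
    have hx_notin : x ∉ ({u, u'} : Finset ι) := by
      simp only [Finset.mem_insert, Finset.mem_singleton, not_or]
      exact ⟨hxu, hxu'⟩
    have ht_eq : h t = h x - h v := by rw [← e]; abel
    have hu_eq : h u = h y - h v := by rw [← hcu]; abel
    have hZ : ∑ i ∈ insert t (insert x ({u, u'} : Finset ι)), h i = τ + τ := by
      rw [Finset.sum_insert ht_notin, Finset.sum_insert hx_notin, Finset.sum_pair huu', huu'v, ht_eq, hu_eq,
        ← hPsum]
      have e5 : h x - h v + (h x + (h y - h v + (h y - h v))) =
          (h x + h y) + (h x + h y) - (h v + h v + h v) := by abel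
      rw [e5, three (h v), sub_zero]
    refine hgood _ ?_ hZ
    refine Finset.insert_subset (hS' htS') (Finset.insert_subset hxS ?_)
    exact Finset.insert_subset (hS' hu) (Finset.singleton_subset_iff.mpr (hS' hu'))
  · -- R = {u, u'}: then h v = τ and {v, x, y} has sum τ + τ
    have huR : u ∈ R := m1.resolve_right hvR
    have hu'R : u' ∈ R := m2.resolve_right hvR
    have hRe : ({u, u'} : Finset ι) = R :=
      Finset.eq_of_subset_of_card_le
        (Finset.insert_subset huR (Finset.singleton_subset_iff.mpr hu'R))
        (by rw [hRc, Finset.card_pair huu'])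
    rw [← hRe, Finset.sum_pair huu', huu'v] at hRsum
    -- hRsum : h u + h u = h x
    have hv_eq : h v = h y - h u := by rw [← hcu]; abel
    have hv_notin : v ∉ ({x, y} : Finset ι) := by
      simp only [Finset.mem_insert, Finset.mem_singleton, not_or]
      exact ⟨fun e => hxS' (e ▸ hv), fun e => hyS' (e ▸ hv)⟩
    have hZ : ∑ i ∈ insert v ({x, y} : Finset ι), h i = τ + τ := by
      rw [Finset.sum_insert hv_notin, Finset.sum_pair hxy, hv_eq, ← hRsum, ← hPsum, ← hRsum]
      have e6 : h y - h u + (h u + h u + h y) = (h u + h u + h y) + (h u + h u + h y) - (h u + h u + h u) := by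
        abel
      rw [e6, three (h u), sub_zero]
    exact hgood _ (Finset.insert_subset (hS' hv) hPS) hZ

/-- ONE PAIR LEAVES AT MOST TWO TRIPLES: if `{x, y}` represents `τ` then `N_3(τ) ≤ 2`. -/
theorem soloBlind_hgood_pair_triples_le_two (three : ∀ g : G, g + g + g = 0) {h : ι → G} {S : Finset ι}
    (zsf : ∀ T ⊆ S, T.Nonempty → ∑ i ∈ T, h i ≠ 0) {τ : G}
    (hgood : ∀ T ⊆ S, ∑ i ∈ T, h i ≠ τ + τ) {x y : ι}
    (hP : ({x, y} : Finset ι) ∈ soloBlindSeqRep h S 2 τ) :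
    (soloBlindSeqRep h S 3 τ).card ≤ 2 := by
  obtain ⟨hPS, hPc, hPsum⟩ := soloBlind_mem_seqRep.mp hP
  have hxy : x ≠ y := by
    intro e; rw [e] at hPc; simp at hPc
  have hxS : x ∈ S := hPS (Finset.mem_insert_self x {y})
  have hyS : y ∈ S := hPS (Finset.mem_insert_of_mem (Finset.mem_singleton_self y))
  have hS' : S \ {x, y} ⊆ S := Finset.sdiff_subset
  have hxS' : x ∉ S \ {x, y} := by simp
  have hyS' : y ∉ S \ {x, y} := by simp
  have zsf' : ∀ T ⊆ S \ {x, y}, T.Nonempty → ∑ i ∈ T, h i ≠ 0 := fun T hT => zsf T (hT.trans hS')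
  have hgb := soloBlind_hgood_of_outside_value three zsf hS' hyS hyS'
  have hga := soloBlind_hgood_of_outside_value three zsf hS' hxS hxS'
  have hAx : (soloBlindSeqRep h (S \ {x, y}) 2 (h y)).card ≤ 2 :=
    soloBlind_seqRep_two_card_le_two_of_hgood three h _ zsf' (h y) hgb
  have hAy : (soloBlindSeqRep h (S \ {x, y}) 2 (h x)).card ≤ 2 :=
    soloBlind_seqRep_two_card_le_two_of_hgood three h _ zsf' (h x) hga
  have hle := soloBlind_hgood_triples_le_links zsf hgood hP
  -- two pairs on one side kill the other side
  have step : ∀ {z z' : ι}, ({z, z'} : Finset ι) ∈ soloBlindSeqRep h S 2 τ → z ∈ S → z' ∈ S →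
      z ∉ S \ {x, y} → z' ∉ S \ {x, y} →
      (soloBlindSeqRep h (S \ {x, y}) 2 (h z')).card = 2 →
      (soloBlindSeqRep h (S \ {x, y}) 2 (h z)).card = 0 := by
    intro z z' hPz hzS hz'S hzS' hz'S' h2
    obtain ⟨Q₁, Q₂, hne, hQQ⟩ := Finset.card_eq_two.mp h2
    have hQ₁ : Q₁ ∈ soloBlindSeqRep h (S \ {x, y}) 2 (h z') := by
      rw [hQQ]; exact Finset.mem_insert_self _ _
    have hQ₂ : Q₂ ∈ soloBlindSeqRep h (S \ {x, y}) 2 (h z') := by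
      rw [hQQ]; exact Finset.mem_insert_of_mem (Finset.mem_singleton_self _)
    have hgz' := soloBlind_hgood_of_outside_value three zsf hS' hz'S hz'S'
    have hmeet : ¬ Disjoint Q₁ Q₂ := fun hd => soloBlind_hgood_not_disjoint hgz' hQ₁ hQ₂ hd
    obtain ⟨u, u', v, hu, hu', hv, huu', huv, hu'v, hcu, hcu', -, -⟩ :=
      soloBlind_two_pairs_share hQ₁ hQ₂ hne hmeet
    rcases Nat.eq_zero_or_pos (soloBlindSeqRep h (S \ {x, y}) 2 (h z)).card with h0 | hpos
    · exact h0
    · exfalso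
      obtain ⟨R, hR⟩ := Finset.card_pos.mp hpos
      exact soloBlind_hgood_key three hgood hPz hS' hzS' hz'S' hu hu' hv huu' huv hu'v hcu hcu' hR
  have s1 := step hP hxS hyS hxS' hyS'
  have hP' : ({y, x} : Finset ι) ∈ soloBlindSeqRep h S 2 τ := by rw [Finset.pair_comm]; exact hP
  have s2 := step hP' hyS hxS hyS' hxS'
  rcases Nat.lt_or_ge (soloBlindSeqRep h (S \ {x, y}) 2 (h y)).card 2 with h1 | h1
  · rcases Nat.lt_or_ge (soloBlindSeqRep h (S \ {x, y}) 2 (h x)).card 2 with h2 | h2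
    · omega
    · have e2 := s2 (le_antisymm hAy h2); omega
  · have e1 := s1 (le_antisymm hAx h1); omega

/-- (E≤3) OFF THE DIAGONAL: if some index has value `τ` or some pair represents `τ`, then
`N_3 + 2·N_2 + 4·N_1 ≤ 4`. -/
theorem soloBlind_window_three_off_diagonal (three : ∀ g : G, g + g + g = 0) (h : ι → G) (S : Finset ι)
    (zsf : ∀ T ⊆ S, T.Nonempty → ∑ i ∈ T, h i ≠ 0) (τ : G)
    (hgood : ∀ T ⊆ S, ∑ i ∈ T, h i ≠ τ + τ)
    (hoff : (soloBlindSeqRep h S 1 τ).card ≠ 0 ∨ (soloBlindSeqRep h S 2 τ).card ≠ 0) :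
    (soloBlindSeqRep h S 3 τ).card + 2 * (soloBlindSeqRep h S 2 τ).card +
      4 * (soloBlindSeqRep h S 1 τ).card ≤ 4 := by
  have h1 : (soloBlindSeqRep h S 1 τ).card = (S.filter (fun i => h i = τ)).card :=
    soloBlind_seqRep_one_card h S τ
  have hm1 : (S.filter (fun i => h i = τ)).card ≤ 1 := soloBlind_hgood_valueClass_tau_le_one hgood
  have hN2 : (soloBlindSeqRep h S 2 τ).card ≤ 2 :=
    soloBlind_seqRep_two_card_le_two_of_hgood three h S zsf τ hgood
  by_cases hm : (S.filter (fun i => h i = τ)).card = 0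
  · -- N_1 = 0, hence N_2 ≠ 0
    have hN2pos : 0 < (soloBlindSeqRep h S 2 τ).card := by
      rcases hoff with h0 | h0
      · exact absurd (h1.trans hm) h0
      · exact Nat.pos_of_ne_zero h0
    obtain ⟨P, hPmem⟩ := Finset.card_pos.mp hN2pos
    obtain ⟨x, y, hxy, rfl, hx, hy, hs⟩ := soloBlind_mem_seqRep_two hPmem
    have hN3 : (soloBlindSeqRep h S 3 τ).card ≤ 2 := soloBlind_hgood_pair_triples_le_two three zsf hgood hPmem
    rcases Nat.lt_or_ge (soloBlindSeqRep h S 2 τ).card 2 with hlt | hge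
    · omega
    · -- N_2 = 2: the two pairs share an index and exclude all triples
      obtain ⟨P₁, P₂, hne, hPP⟩ := Finset.card_eq_two.mp (le_antisymm hN2 hge)
      have hP₁ : P₁ ∈ soloBlindSeqRep h S 2 τ := by rw [hPP]; exact Finset.mem_insert_self _ _
      have hP₂ : P₂ ∈ soloBlindSeqRep h S 2 τ := by
        rw [hPP]; exact Finset.mem_insert_of_mem (Finset.mem_singleton_self _)
      have hmeet : ¬ Disjoint P₁ P₂ := fun hd => soloBlind_hgood_not_disjoint hgood hP₁ hP₂ hd
      obtain ⟨u, u', v, -, -, -, huu', -, -, -, -, rfl, rfl⟩ :=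
        soloBlind_two_pairs_share hP₁ hP₂ hne hmeet
      have hN3z : (soloBlindSeqRep h S 3 τ).card = 0 := by
        rcases Nat.eq_zero_or_pos (soloBlindSeqRep h S 3 τ).card with h0 | hpos
        · exact h0
        · exfalso
          obtain ⟨M, hM⟩ := Finset.card_pos.mp hpos
          exact soloBlind_hgood_two_pairs_no_triple three zsf hgood hP₁ hP₂ huu' hM
      omega
  · -- N_1 = 1: nothing else represents τ
    have hm1' : (S.filter (fun i => h i = τ)).card = 1 := by omega
    obtain ⟨p, hp⟩ := Finset.card_eq_one.mp hm1'
    have hpS : p ∈ S ∧ h p = τ := by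
      have : p ∈ S.filter (fun i => h i = τ) := by rw [hp]; exact Finset.mem_singleton_self p
      exact Finset.mem_filter.mp this
    have hN2z : (soloBlindSeqRep h S 2 τ).card = 0 := by
      rcases Nat.eq_zero_or_pos (soloBlindSeqRep h S 2 τ).card with h0 | hpos
      · exact h0
      · exfalso
        obtain ⟨T, hT⟩ := Finset.card_pos.mp hpos
        exact soloBlind_hgood_value_tau_kills zsf hgood hpS.1 hpS.2 (le_refl 2) hT
    have hN3z : (soloBlindSeqRep h S 3 τ).card = 0 := by
      rcases Nat.eq_zero_or_pos (soloBlindSeqRep h S 3 τ).card with h0 | hpos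
      · exact h0
      · exfalso
        obtain ⟨T, hT⟩ := Finset.card_pos.mp hpos
        exact soloBlind_hgood_value_tau_kills zsf hgood hpS.1 hpS.2 (by norm_num) hT
    omega

/-- (E≤3) GIVEN H(3): with H(3) (`N_3 ≤ 4`) at the point `(S, τ)` as a hypothesis, the full window inequality
`N_3 + 2·N_2 + 4·N_1 ≤ 4` holds. -/
theorem soloBlind_window_three_of_H3 (three : ∀ g : G, g + g + g = 0) (h : ι → G) (S : Finset ι)
    (zsf : ∀ T ⊆ S, T.Nonempty → ∑ i ∈ T, h i ≠ 0) (τ : G)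
    (hgood : ∀ T ⊆ S, ∑ i ∈ T, h i ≠ τ + τ) (hH3 : (soloBlindSeqRep h S 3 τ).card ≤ 4) :
    (soloBlindSeqRep h S 3 τ).card + 2 * (soloBlindSeqRep h S 2 τ).card +
      4 * (soloBlindSeqRep h S 1 τ).card ≤ 4 := by
  by_cases hoff : (soloBlindSeqRep h S 1 τ).card ≠ 0 ∨ (soloBlindSeqRep h S 2 τ).card ≠ 0
  · exact soloBlind_window_three_off_diagonal three h S zsf τ hgood hoff
  · rw [not_or, not_not, not_not] at hoff
    omega

/-- H₂(3) OFF THE DIAGONAL: if some pair represents `τ` then `N_3 + N_2 ≤ 4` (indeed `≤ 3`). -/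
theorem soloBlind_H2_three_of_pair (three : ∀ g : G, g + g + g = 0) (h : ι → G) (S : Finset ι)
    (zsf : ∀ T ⊆ S, T.Nonempty → ∑ i ∈ T, h i ≠ 0) (τ : G)
    (hgood : ∀ T ⊆ S, ∑ i ∈ T, h i ≠ τ + τ) (hpair : (soloBlindSeqRep h S 2 τ).card ≠ 0) :
    (soloBlindSeqRep h S 3 τ).card + (soloBlindSeqRep h S 2 τ).card ≤ 3 := by
  have := soloBlind_window_three_off_diagonal three h S zsf τ hgood (Or.inr hpair)
  have hpos := Nat.pos_of_ne_zero hpair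
  omega

/-! ### Sharpness witness over `𝔽₃³` (by `decide`) -/

/-- `N_2 = 1, N_3 = 2` is attained with `τ` H-good (so `soloBlind_hgood_pair_triples_le_two` and the case
`N_2 = 1` of (E≤3) are sharp): `h = (e₃, e₃, e₂, e₂+e₃, e₁)` on `Fin 5` in `𝔽₃³`, `τ = e₁+e₂+e₃`; the pair is
`{3, 4}`, the triples are `{0, 2, 4}` and `{1, 2, 4}`, and `N_3 + 2·N_2 + 4·N_1 = 4`. -/
theorem soloBlind_window_three_pair_attained :
    let h : Fin 5 → (Fin 3 → ZMod 3) := ![![0, 0, 1], ![0, 0, 1], ![0, 1, 0], ![0, 1, 1], ![1, 0, 0]]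
    (∀ T ⊆ (Finset.univ : Finset (Fin 5)), T.Nonempty → ∑ i ∈ T, h i ≠ 0) ∧
      (∀ T ⊆ (Finset.univ : Finset (Fin 5)), ∑ i ∈ T, h i ≠ ![1, 1, 1] + ![1, 1, 1]) ∧
      (soloBlindSeqRep h Finset.univ 1 ![1, 1, 1]).card = 0 ∧
      (soloBlindSeqRep h Finset.univ 2 ![1, 1, 1]).card = 1 ∧
      (soloBlindSeqRep h Finset.univ 3 ![1, 1, 1]).card = 2 := by
  refine ⟨?_, ?_, ?_, ?_, ?_⟩
  · intro T _ hTne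
    revert T
    decide
  · intro T _
    revert T
    decide
  · decide
  · decide
  · decide

end Summit.MatrixMultiplication.MatrixMultiplication.Theorems
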